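import Literature.Analysis.FluidPDE.PassiveScalarBoundedSlice
import Literature.Analysis.FluidPDE.PassiveScalarEnergyPointwise
import Literature.Analysis.FluidPDE.PassiveScalarSpectralBounds
import HarnessLib

/-!
# Energy identity for BOUNDED passive scalars along `L²` drifts, II: the remainder vanishes

Analysis/FluidPDE proof-support file (everything proved; no definitions, no named facts), second of
the files discharging `MescoliniPitchoSorella2025_thm24` (Mescolini–Pitcho–Sorella 2025, Thm. 2.4).
Time-integrated bookkeeping for a weak solution `θ` of `∂ₜθ + u·∇θ = κΔθ` on `T^d × [0,T)`
(`Torus.IsWeakScalarTransportOn`) which is BOUNDED, `|θ| ≤ M` a.e. on `(0,T) × T^d`, along a drift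
`u ∈ L²((0,T) × T^d)`, mollified in space by the torus kernels `kₙ = kernel εₙ`,
`εₙ = 1/(4(n+1))`, `Aₙ = θ ⋆ kₙ`, `Bₙ = Aₙ ⋆ kₙ`:

* `tendsto_eScalarGradNormSq_convolution_kernel` — **the spectral gradient norm of the mollified
  slice converges**, `‖∇(f ⋆ kₙ)‖²_{L²} → ‖∇f‖²_{L²}` in `ℝ≥0∞` for every integrable `f` (finite or
  not: `k̂ₙ → 1` termwise gives `liminf ≥` by Fatou for series, and `|k̂ₙ| ≤ 1` gives `≤`);
* `lintegral_enorm_mul_norm_sq_le` — the truncation bound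
  `∫ |w|²‖v‖² ≤ K² ∫ |w|² + C² ∫_{‖v‖ > K} ‖v‖²` for `|w| ≤ C`;
* `tendsto_lintegral_eLpNorm_conv_sub_sq` — `∫₀ᵀ ‖θ(s) ⋆ kₙ - θ(s)‖²_{L²} ds → 0` (dominated
  convergence; the step inside `energy_ineq_holds`, recorded once as a lemma);
* `tendsto_lintegral_tail_sq` — `∫₀ᵀ ∫_{‖u‖ > K} ‖u‖² → 0` as `K → ∞` for `u ∈ L²_{t,x}`;
* **`tendsto_lintegral_remainder_sq`** — the weighted remainder of the mollified energy balance
  (`PassiveScalarBoundedSlice.enorm_integral_conv_mul_flux_add_le`) vanishes in `L²` in time: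
  `∫₀ᵀ ‖(θ(s) - Bₙ(s))·‖u(s)‖‖²_{L²} ds → 0` (`|θ - Bₙ| ≤ 2M`, `θ(s) - Bₙ(s) → 0` in `L²`, truncation
  of `u` at height `K` and the tail estimate) — the replacement, for bounded solutions and `L²`
  drifts, of the commutator estimate `r^δ → 0` of Mescolini–Pitcho–Sorella (proof of Thm. 2.4) /
  Bonicatto–Ciampa–Crippa (Lemma 3.1); with its finiteness `lintegral_remainder_sq_lt_top`.

## Mathlib / tree search

Tree (reused by name): `eScalarGradNormSq_eq_tsum`, `tsum_le_liminf_tsum_of_tendsto`,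
`eLpNorm_sub_conv_conv_le` (`PassiveScalarEnergySlice`), `aemeasurable_eLpNorm_two_of_uncurry`,
`aemeasurable_eLpNorm_conv_sub` (`PassiveScalarProofs` / `…EnergyProofs`),
`aestronglyMeasurable_uncurry_convolution` (`TorusConvolution`), `mFourierCoeff_ofReal_convolution_kernel`;
a local copy of the tree's `tendsto_mFourierCoeff_kernel` (`DuchonRobertLionsEnergyEqualityGeneral`,
not imported to keep the passive-scalar cluster free of the Navier–Stokes chain).
Mathlib: `tendsto_lintegral_of_dominated_convergence'`, `lintegral_prod`, `ENNReal.tendsto_atTop_zero`.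

## References

* G. Mescolini, J. Pitcho, M. Sorella, Ann. Mat. Pura Appl. (4) 204 (2025) 1667–1687, Thm. 2.4, proof
  pp. 1671–1674. [`MescoliniPitchoSorella2025`]
* P. Bonicatto, G. Ciampa, G. Crippa, J. Evol. Equ. 24 (2024), Paper No. 1, Lemma 3.1, Thm. 3.3.
  [`BonicattoCiampaCrippa2023`]
* L. Grafakos, *Classical Fourier Analysis*, 3rd ed. (2014), Prop. 3.1.2 (9). [`Grafakos2014`]
-/

noncomputable section

open MeasureTheory TopologicalSpace Set Function Filter Metric ContinuousLinearMap UnitAddTorus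
open _root_.Topology
open scoped ENNReal NNReal Convolution ContDiff InnerProductSpace

namespace Literature.Analysis.FluidPDE

namespace Torus

variable {d : Type*} [Fintype d]

/-! ## Slice tools -/

section SliceTools

/-- Local copy of the tree's `tendsto_mFourierCoeff_kernel` (`DuchonRobertLionsEnergyEqualityGeneral`):
`𝓕(kernel εₙ)(k) → 1` along `εₙ → 0⁺`. [folklore] -/
private theorem tendsto_mFourierCoeff_kernel' {ε : ℕ → ℝ} (hε : ∀ n, 0 < ε n) (hε' : ∀ n, ε n ≤ 1 / 4)
    (hε0 : Tendsto ε atTop (𝓝 0)) (k : d → ℤ) :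
    Tendsto (fun n => mFourierCoeff (fun x => (FunctionSpaces.Torus.kernel (ε n) x : ℂ)) k) atTop (𝓝 1) := by
  rw [Metric.tendsto_atTop]
  intro δ hδ
  have hcont : ContinuousAt (fun y : UnitAddTorus d => mFourier (-k) y) 0 := (mFourier (-k)).continuous.continuousAt
  have h0 : mFourier (-k) (0 : UnitAddTorus d) = 1 := by
    simp [mFourier]
  obtain ⟨r, hr, hry⟩ := Metric.continuousAt_iff.1 hcont (δ / 2) (half_pos hδ)
  obtain ⟨N₀, hN₀⟩ : ∃ N₀, ∀ n ≥ N₀, ε n < r := by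
    have h := (hε0.eventually (gt_mem_nhds hr))
    rw [eventually_atTop] at h
    exact h
  refine ⟨N₀, fun n hn => ?_⟩
  set K : UnitAddTorus d → ℝ := FunctionSpaces.Torus.kernel (ε n) with hKdef
  have hKc : Continuous K := FunctionSpaces.Torus.continuous_kernel (hε n) (hε' n)
  have hK0 : ∀ y, 0 ≤ K y := fun y => FunctionSpaces.Torus.kernel_nonneg (hε n).le y
  have hK1 : ∫ y, K y = 1 := FunctionSpaces.Torus.integral_kernel (hε n) (hε' n)
  have hKs : support K ⊆ ball 0 (ε n) := FunctionSpaces.Torus.support_kernel_subset (hε n)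
  have hKi : Integrable K volume := hKc.integrable_of_hasCompactSupport (HasCompactSupport.of_compactSpace _)
  have hKci : Integrable (fun y => (K y : ℂ)) volume := Complex.ofRealCLM.integrable_comp hKi
  have hrepr : mFourierCoeff (fun x => (K x : ℂ)) k - 1 = ∫ y, (mFourier (-k) y - 1) * (K y : ℂ) := by
    have hK1c : ∫ y, (K y : ℂ) = 1 := by
      rw [integral_complex_ofReal, hK1, Complex.ofReal_one]
    have i1 : Integrable (fun y => mFourier (-k) y * (K y : ℂ)) volume :=
      hKci.bdd_mul (c := 1) (mFourier (-k)).continuous.aestronglyMeasurable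
        (ae_of_all _ fun y => ((mFourier (-k)).norm_coe_le_norm y).trans_eq mFourier_norm)
    have hR : ∫ y, (mFourier (-k) y - 1) * (K y : ℂ) = (∫ y, mFourier (-k) y * (K y : ℂ)) - ∫ y, (K y : ℂ) := by
      rw [← integral_sub i1 hKci]
      refine integral_congr_ae (ae_of_all _ fun y => ?_)
      ring
    rw [hR, hK1c, FunctionSpaces.Torus.mFourierCoeff_eq_integral_volume]
    simp only [smul_eq_mul]
  rw [dist_eq_norm, hrepr]
  have hpt : ∀ y, ‖(mFourier (-k) y - 1) * (K y : ℂ)‖ ≤ δ / 2 * K y := by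
    intro y
    by_cases hy : K y = 0
    · simp [hy]
    · have hyb : y ∈ ball (0 : UnitAddTorus d) (ε n) := hKs (mem_support.2 hy)
      have hyr : dist y 0 < r := (mem_ball.1 hyb).trans (hN₀ n hn)
      have h1 : ‖mFourier (-k) y - 1‖ ≤ δ / 2 := by
        have h := hry hyr
        rw [h0, dist_eq_norm] at h
        exact h.le
      rw [norm_mul, Complex.norm_real, Real.norm_of_nonneg (hK0 y)]
      exact mul_le_mul_of_nonneg_right h1 (hK0 y)
  calc ‖∫ y, (mFourier (-k) y - 1) * (K y : ℂ)‖ ≤ ∫ y, ‖(mFourier (-k) y - 1) * (K y : ℂ)‖ :=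
        norm_integral_le_integral_norm _
    _ ≤ ∫ y, δ / 2 * K y := integral_mono_of_nonneg (ae_of_all _ fun y => norm_nonneg _)
        (hKi.const_mul _) (ae_of_all _ hpt)
    _ = δ / 2 := by rw [integral_const_mul, hK1, mul_one]
    _ < δ := half_lt_self hδ

/-- **The spectral gradient norm of the mollified scalar converges to that of the scalar**: for an
integrable `f` and scales `εₙ → 0⁺`, `eScalarGradNormSq (f ⋆ kernel εₙ) → eScalarGradNormSq f` in
`ℝ≥0∞` (whether or not the limit is finite): `𝓕(f ⋆ kₙ) = f̂ · k̂ₙ` with `k̂ₙ → 1` gives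
`liminf ≥` by Fatou for series, and `|k̂ₙ| ≤ 1` gives `≤` for every `n`
(the convolution theorem, Grafakos 2014, Prop. 3.1.2 (9)). [cite: Grafakos2014, Prop. 3.1.2 (9)] -/
theorem tendsto_eScalarGradNormSq_convolution_kernel {f : UnitAddTorus d → ℝ} (hf : Integrable f volume)
    {ε : ℕ → ℝ} (hε : ∀ n, 0 < ε n) (hε' : ∀ n, ε n ≤ 1 / 4) (hε0 : Tendsto ε atTop (𝓝 0)) :
    Tendsto (fun n => eScalarGradNormSq (f ⋆ FunctionSpaces.Torus.kernel (ε n))) atTop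
      (𝓝 (eScalarGradNormSq f)) := by
  have hle : ∀ n, eScalarGradNormSq (f ⋆ FunctionSpaces.Torus.kernel (ε n)) ≤ eScalarGradNormSq f := fun n =>
    eScalarGradNormSq_convolution_kernel_le hf (hε n) (hε' n)
  have hlim : eScalarGradNormSq f ≤ liminf (fun n => eScalarGradNormSq (f ⋆ FunctionSpaces.Torus.kernel (ε n))) atTop := by
    have e : ∀ g : UnitAddTorus d → ℝ, eScalarGradNormSq g =
        ∑' k : d → ℤ, ENNReal.ofReal (4 * Real.pi ^ 2) *
          (ENNReal.ofReal (FunctionSpaces.Torus.freqNormSq k) * ‖mFourierCoeff (fun x => (g x : ℂ)) k‖ₑ ^ 2) := by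
      intro g
      rw [eScalarGradNormSq_eq_tsum, ENNReal.tsum_mul_left]
    rw [e f]
    simp_rw [e]
    refine tsum_le_liminf_tsum_of_tendsto fun k => ?_
    refine ENNReal.Tendsto.const_mul ?_ (Or.inr ENNReal.ofReal_ne_top)
    refine ENNReal.Tendsto.const_mul ?_ (Or.inr ENNReal.ofReal_ne_top)
    have hcoef : Tendsto (fun n => mFourierCoeff (fun x => ((f ⋆ FunctionSpaces.Torus.kernel (ε n)) x : ℂ)) k) atTop
        (𝓝 (mFourierCoeff (fun x => (f x : ℂ)) k)) := by
      have h1 := (tendsto_mFourierCoeff_kernel' hε hε' hε0 k).const_mul (mFourierCoeff (fun x => (f x : ℂ)) k)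
      rw [mul_one] at h1
      refine h1.congr fun n => ?_
      rw [FunctionSpaces.Torus.mFourierCoeff_ofReal_convolution_kernel hf
        (FunctionSpaces.Torus.continuous_kernel (hε n) (hε' n)) k]
    exact ((ENNReal.continuous_pow 2).tendsto _).comp ((continuous_enorm.tendsto _).comp hcoef)
  exact tendsto_of_le_liminf_of_limsup_le hlim (limsup_le_of_le (by isBoundedDefault) (Eventually.of_forall hle))

variable {v : UnitAddTorus d → EuclideanSpace ℝ d}

/-- **Truncation bound for a weighted `L²` norm**: if `|w| ≤ C` a.e. then, for every real `K`,
`∫ |w|² ‖v‖² ≤ K² ∫ |w|² + C² ∫_{‖v‖ > K} ‖v‖²` (split according to `‖v‖ ≤ K` or not). [cite: MescoliniPitchoSorella2025, Thm. 2.4 proof pp. 1671–1674] -/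
theorem lintegral_enorm_mul_norm_sq_le {w : UnitAddTorus d → ℝ} {C : ℝ}
    (hw : ∀ᵐ y ∂(volume : Measure (UnitAddTorus d)), |w y| ≤ C)
    (hwm : AEStronglyMeasurable w volume) (K : ℝ) :
    ∫⁻ y, ‖w y * ‖v y‖‖ₑ ^ 2 ≤
      (ENNReal.ofReal (K ^ 2) * ∫⁻ y, ‖w y‖ₑ ^ 2) +
        ENNReal.ofReal (C ^ 2) * ∫⁻ y, Set.indicator {y | K < ‖v y‖} (fun y => ‖v y‖ₑ ^ 2) y := by
  rw [← lintegral_const_mul' _ _ ENNReal.ofReal_ne_top, ← lintegral_const_mul' _ _ ENNReal.ofReal_ne_top,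
    ← lintegral_add_left' ((hwm.enorm.pow_const 2).const_mul _)]
  refine lintegral_mono_ae ?_
  filter_upwards [hw] with y hy
  rw [enorm_mul, enorm_norm, mul_pow]
  by_cases hvy : K < ‖v y‖
  · rw [Set.indicator_of_mem (show y ∈ {y | K < ‖v y‖} from hvy)]
    have h1 : ‖w y‖ₑ ^ 2 ≤ ENNReal.ofReal (C ^ 2) := by
      rw [Real.enorm_eq_ofReal_abs, ← ENNReal.ofReal_pow (abs_nonneg _)]
      exact ENNReal.ofReal_le_ofReal (pow_le_pow_left₀ (abs_nonneg _) hy 2)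
    calc ‖w y‖ₑ ^ 2 * ‖v y‖ₑ ^ 2 ≤ ENNReal.ofReal (C ^ 2) * ‖v y‖ₑ ^ 2 := by gcongr
      _ ≤ _ := le_add_self
  · rw [Set.indicator_of_notMem (show y ∉ {y | K < ‖v y‖} from hvy), mul_zero, add_zero]
    have h1 : ‖v y‖ₑ ^ 2 ≤ ENNReal.ofReal (K ^ 2) := by
      rw [← ofReal_norm, ← ENNReal.ofReal_pow (norm_nonneg _)]
      exact ENNReal.ofReal_le_ofReal (pow_le_pow_left₀ (norm_nonneg _) (not_lt.1 hvy) 2)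
    calc ‖w y‖ₑ ^ 2 * ‖v y‖ₑ ^ 2 ≤ ‖w y‖ₑ ^ 2 * ENNReal.ofReal (K ^ 2) := by gcongr
      _ = ENNReal.ofReal (K ^ 2) * ‖w y‖ₑ ^ 2 := mul_comm _ _

end SliceTools

/-! ## Time-integrated bookkeeping for a bounded weak solution along an `L²` drift -/

namespace IsWeakScalarTransportOn

variable {T κ : ℝ} {u : ℝ → UnitAddTorus d → EuclideanSpace ℝ d} {θ₀ : UnitAddTorus d → ℝ}
  {θ : ℝ → UnitAddTorus d → ℝ}

/-- Joint measurability of the double mollification `(s, x) ↦ ((θ(s) ⋆ k) ⋆ k)(x)` on `(0,T) × T^d`.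
[folklore] -/
private theorem aestronglyMeasurable_uncurry_conv_conv (h : IsWeakScalarTransportOn T κ u θ₀ θ)
    {k : UnitAddTorus d → ℝ} (hk : Continuous k) :
    AEStronglyMeasurable (uncurry fun s x => ((θ s ⋆ k) ⋆ k) x)
      (((volume : Measure ℝ).restrict (Ioo 0 T)).prod volume) :=
  FunctionSpaces.Torus.aestronglyMeasurable_uncurry_convolution (lsmul ℝ ℝ)
    (FunctionSpaces.Torus.aestronglyMeasurable_uncurry_convolution (lsmul ℝ ℝ) h.aestronglyMeasurable_uncurry hk) hk

/-- `s ↦ ‖(θ(s) - (θ(s) ⋆ k) ⋆ k)·‖u(s)‖‖_{L²}` is a.e.-measurable on `(0,T)`. [cite: MescoliniPitchoSorella2025, Thm. 2.4 proof pp. 1671–1674] -/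
theorem aemeasurable_eLpNorm_remainder (h : IsWeakScalarTransportOn T κ u θ₀ θ)
    {k : UnitAddTorus d → ℝ} (hk : Continuous k) :
    AEMeasurable (fun s => eLpNorm (fun y => (θ s - (θ s ⋆ k) ⋆ k) y * ‖u s y‖) 2 volume)
      ((volume : Measure ℝ).restrict (Ioo 0 T)) := by
  refine aemeasurable_eLpNorm_two_of_uncurry (f := fun s y => (θ s - (θ s ⋆ k) ⋆ k) y * ‖u s y‖) ?_
  have hB := h.aestronglyMeasurable_uncurry_conv_conv hk
  have e : uncurry (fun s y => (θ s - (θ s ⋆ k) ⋆ k) y * ‖u s y‖) =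
      fun p : ℝ × UnitAddTorus d => (uncurry θ p - uncurry (fun s x => ((θ s ⋆ k) ⋆ k) x) p) * ‖uncurry u p‖ := by
    funext p
    rfl
  rw [e]
  exact (h.aestronglyMeasurable_uncurry.sub hB).mul h.aestronglyMeasurable_uncurry_velocity.norm

/-- `s ↦ ‖θ(s) - (θ(s) ⋆ k) ⋆ k‖_{L²}` is a.e.-measurable on `(0,T)`. [folklore] -/
private theorem aemeasurable_eLpNorm_sub_conv_conv (h : IsWeakScalarTransportOn T κ u θ₀ θ)
    {k : UnitAddTorus d → ℝ} (hk : Continuous k) :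
    AEMeasurable (fun s => eLpNorm (θ s - (θ s ⋆ k) ⋆ k) 2 volume) ((volume : Measure ℝ).restrict (Ioo 0 T)) := by
  refine aemeasurable_eLpNorm_two_of_uncurry (f := fun s => θ s - (θ s ⋆ k) ⋆ k) ?_
  have hB := h.aestronglyMeasurable_uncurry_conv_conv hk
  have e : uncurry (fun s => θ s - (θ s ⋆ k) ⋆ k) =
      fun p : ℝ × UnitAddTorus d => uncurry θ p - uncurry (fun s x => ((θ s ⋆ k) ⋆ k) x) p := by
    funext p
    rfl
  rw [e]
  exact h.aestronglyMeasurable_uncurry.sub hB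

/-- **`∫₀ᵀ ‖θ(s) ⋆ kₙ - θ(s)‖²_{L²} ds → 0`** along the torus kernels `kₙ = kernel εₙ`,
`εₙ = 1/(4(n+1))` (slice-wise `L²` convergence of the mollification, dominated by `(2‖θ‖_{L^∞L²})²`).
[cite: BonicattoCiampaCrippa2023, Thm. 3.3 proof (3.1)–(3.4)] -/
theorem tendsto_lintegral_eLpNorm_conv_sub_sq (h : IsWeakScalarTransportOn T κ u θ₀ θ) :
    Tendsto (fun n : ℕ => ∫⁻ s in Ioo 0 T,
      eLpNorm (θ s ⋆ FunctionSpaces.Torus.kernel (1 / (4 * ((n : ℝ) + 1))) - θ s) 2 volume ^ 2) atTop (𝓝 0) := by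
  set μT : Measure ℝ := (volume : Measure ℝ).restrict (Ioo 0 T) with hμT
  haveI : IsFiniteMeasure μT := by rw [hμT]; infer_instance
  obtain ⟨hε, hε', hε0⟩ := molRadius_spec
  set ε : ℕ → ℝ := fun n => 1 / (4 * ((n : ℝ) + 1)) with hε_def
  have hkS : ∀ n, FunctionSpaces.Torus.IsSmooth (FunctionSpaces.Torus.kernel (d := d) (ε n)) :=
    fun n => FunctionSpaces.Torus.isSmooth_kernel (hε n) (hε' n)
  have hk1 : ∀ n, ∫⁻ y, ‖FunctionSpaces.Torus.kernel (d := d) (ε n) y‖ₑ = 1 :=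
    fun n => FunctionSpaces.Torus.lintegral_enorm_kernel (hε n) (hε' n)
  obtain ⟨C₁, hC₁⟩ := h.exists_eLpNorm_le
  have hgood : ∀ᵐ s ∂μT, Integrable (θ s) volume ∧ MemLp (θ s) 2 volume ∧ eLpNorm (θ s) 2 volume ≤ C₁ := by
    filter_upwards [h.ae_slice_integrable₁, h.ae_memLp_two, hC₁] with s h1 h4 h5
    exact ⟨h1.1, h4, h5⟩
  set E : ℕ → ℝ → ℝ≥0∞ := fun n s =>
    eLpNorm (θ s ⋆ FunctionSpaces.Torus.kernel (ε n) - θ s) 2 volume with hE_def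
  have hEm : ∀ n, AEMeasurable (E n) μT := fun n => h.aemeasurable_eLpNorm_conv_sub (hkS n).continuous
  have hEle : ∀ n, ∀ᵐ s ∂μT, E n s ≤ 2 * C₁ := by
    intro n
    filter_upwards [hgood] with s hs
    have hAm : AEStronglyMeasurable (θ s ⋆ FunctionSpaces.Torus.kernel (ε n)) volume :=
      (FunctionSpaces.Torus.continuous_convolution hs.1 (hkS n).continuous).aestronglyMeasurable
    calc E n s ≤ eLpNorm (θ s ⋆ FunctionSpaces.Torus.kernel (ε n)) 2 volume + eLpNorm (θ s) 2 volume :=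
          eLpNorm_sub_le hAm hs.2.1.1 one_le_two
      _ ≤ (∫⁻ y, ‖FunctionSpaces.Torus.kernel (ε n) y‖ₑ) * eLpNorm (θ s) 2 volume + eLpNorm (θ s) 2 volume := by
          gcongr
          exact FunctionSpaces.Torus.eLpNorm_convolution_le hs.1.aestronglyMeasurable
            (hkS n).continuous.aestronglyMeasurable one_le_two
      _ ≤ 2 * C₁ := by
          rw [hk1 n, one_mul, two_mul]
          exact add_le_add hs.2.2 hs.2.2
  have hE0 : ∀ᵐ s ∂μT, Tendsto (fun n => E n s) atTop (𝓝 0) := by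
    filter_upwards [hgood] with s hs
    exact FunctionSpaces.Torus.tendsto_eLpNorm_convolution_sub_self hs.2.1
      (fun n y => FunctionSpaces.Torus.kernel_nonneg (hε n).le y)
      (fun n => FunctionSpaces.Torus.integral_kernel (hε n) (hε' n))
      (fun n => FunctionSpaces.Torus.support_kernel_subset (hε n))
      (fun n => FunctionSpaces.Torus.continuous_kernel (hε n) (hε' n)) hε0
  have hb : ∫⁻ _ : ℝ, ((2 : ℝ≥0∞) * C₁) ^ 2 ∂μT ≠ ⊤ := by
    rw [lintegral_const]
    exact ENNReal.mul_ne_top (ENNReal.pow_ne_top (ENNReal.mul_ne_top ENNReal.ofNat_ne_top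
      ENNReal.coe_ne_top)) (measure_ne_top _ _)
  have hlim : ∀ᵐ s ∂μT, Tendsto (fun n => E n s ^ 2) atTop (𝓝 ((fun _ => (0 : ℝ≥0∞)) s)) := by
    filter_upwards [hE0] with s hs
    have := ((ENNReal.continuous_pow 2).tendsto 0).comp hs
    rw [zero_pow two_ne_zero] at this
    exact this
  have := tendsto_lintegral_of_dominated_convergence' (fun _ => ((2 : ℝ≥0∞) * C₁) ^ 2)
    (fun n => (hEm n).pow_const 2) (fun n => (hEle n).mono fun s hs => by
      dsimp only
      gcongr) hb hlim
  simp only [lintegral_zero] at this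
  exact this

/-- **The `L²_{t,x}` tail of the drift vanishes**: for `u ∈ L²((0,T) × T^d)`,
`∫₀ᵀ ∫_{‖u‖ > K} ‖u‖² → 0` as `K → ∞` (dominated convergence on `(0,T) × T^d`). [cite: MescoliniPitchoSorella2025, Thm. 2.4 proof pp. 1671–1674] -/
theorem tendsto_lintegral_tail_sq (h : IsWeakScalarTransportOn T κ u θ₀ θ)
    (hu2 : ∫⁻ t in Ioo 0 T, ∫⁻ x, ‖u t x‖ₑ ^ 2 < ⊤) :
    Tendsto (fun K : ℕ => ∫⁻ s in Ioo 0 T, ∫⁻ y,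
      Set.indicator {y | (K : ℝ) < ‖u s y‖} (fun y => ‖u s y‖ₑ ^ 2) y) atTop (𝓝 0) := by
  set μT : Measure ℝ := (volume : Measure ℝ).restrict (Ioo 0 T) with hμT
  have hum : AEStronglyMeasurable (uncurry u) (μT.prod volume) := h.aestronglyMeasurable_uncurry_velocity
  -- the integrands on the product
  set F : ℕ → ℝ × UnitAddTorus d → ℝ≥0∞ := fun K p =>
    Set.indicator {p : ℝ × UnitAddTorus d | (K : ℝ) < ‖uncurry u p‖} (fun p => ‖uncurry u p‖ₑ ^ 2) p with hF
  have hFm : ∀ K, AEMeasurable (F K) (μT.prod volume) := by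
    intro K
    refine AEMeasurable.indicator₀ (hum.enorm.pow_const 2) ?_
    exact nullMeasurableSet_lt aemeasurable_const hum.norm.aemeasurable
  have hiter : ∀ K : ℕ, ∫⁻ s, (∫⁻ y, Set.indicator {y | (K : ℝ) < ‖u s y‖} (fun y => ‖u s y‖ₑ ^ 2) y) ∂μT =
      ∫⁻ p, F K p ∂(μT.prod volume) := by
    intro K
    rw [lintegral_prod _ (hFm K)]
    rfl
  refine (tendsto_congr hiter).2 ?_
  have hfin : ∫⁻ p, ‖uncurry u p‖ₑ ^ 2 ∂(μT.prod volume) ≠ ⊤ := by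
    rw [lintegral_prod _ (hum.enorm.pow_const 2)]
    exact hu2.ne
  have hbound : ∀ K, ∀ᵐ p ∂(μT.prod volume), F K p ≤ ‖uncurry u p‖ₑ ^ 2 := fun K =>
    ae_of_all _ fun p => Set.indicator_le_self _ _ p
  have hptw : ∀ᵐ p ∂(μT.prod volume), Tendsto (fun K => F K p) atTop (𝓝 0) := by
    refine ae_of_all _ fun p => ?_
    obtain ⟨N, hN⟩ := exists_nat_gt ‖uncurry u p‖
    refine tendsto_atTop_of_eventually_const (i₀ := N) fun K hK => ?_
    have hnot : p ∉ {p : ℝ × UnitAddTorus d | (K : ℝ) < ‖uncurry u p‖} := by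
      simp only [Set.mem_setOf_eq, not_lt]
      exact hN.le.trans (by exact_mod_cast hK)
    exact Set.indicator_of_notMem hnot _
  have := tendsto_lintegral_of_dominated_convergence' (fun p => ‖uncurry u p‖ₑ ^ 2) hFm hbound hfin hptw
  simpa using this

/-- **The remainder slices are dominated**: with `|θ| ≤ M` a.e. and `Bₙ = (θ ⋆ kₙ) ⋆ kₙ`, for a.e.
`s ∈ (0,T)` and every real `K`,
`‖(θ(s) - Bₙ(s))·‖u(s)‖‖²_{L²} ≤ K² ‖θ(s) - Bₙ(s)‖²_{L²} + (2M)² ∫_{‖u(s)‖ > K} ‖u(s)‖²`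
(`|Bₙ| ≤ M` as well, the kernel being nonnegative with unit mass). [cite: MescoliniPitchoSorella2025, Thm. 2.4 proof pp. 1671–1674] -/
theorem ae_remainder_sq_le (h : IsWeakScalarTransportOn T κ u θ₀ θ) {M : ℝ}
    (hθb : ∀ᵐ t ∂(volume.restrict (Ioo 0 T)), ∀ᵐ x ∂(volume : Measure (UnitAddTorus d)), |θ t x| ≤ M)
    {ε : ℝ} (hε : 0 < ε) (hε' : ε ≤ 1 / 4) (K : ℝ) :
    ∀ᵐ s ∂(volume.restrict (Ioo 0 T)),
      eLpNorm (fun y => (θ s - (θ s ⋆ FunctionSpaces.Torus.kernel ε) ⋆ FunctionSpaces.Torus.kernel ε) y * ‖u s y‖) 2 volume ^ 2 ≤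
        ENNReal.ofReal (K ^ 2) * eLpNorm (θ s - (θ s ⋆ FunctionSpaces.Torus.kernel ε) ⋆ FunctionSpaces.Torus.kernel ε) 2 volume ^ 2 +
          ENNReal.ofReal ((2 * M) ^ 2) * ∫⁻ y, Set.indicator {y | K < ‖u s y‖} (fun y => ‖u s y‖ₑ ^ 2) y := by
  have hk : FunctionSpaces.Torus.IsSmooth (FunctionSpaces.Torus.kernel (d := d) ε) := FunctionSpaces.Torus.isSmooth_kernel hε hε'
  filter_upwards [hθb, h.ae_slice_integrable₁] with s hsb hs
  set k := FunctionSpaces.Torus.kernel (d := d) ε with hk_def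
  have hA : FunctionSpaces.Torus.IsSmooth (θ s ⋆ k) := FunctionSpaces.Torus.isSmooth_convolution hs.1 hk
  have hB : FunctionSpaces.Torus.IsSmooth ((θ s ⋆ k) ⋆ k) := FunctionSpaces.Torus.isSmooth_convolution hA.integrable hk
  have hAb : ∀ x, |(θ s ⋆ k) x| ≤ M := abs_convolution_le_of_ae_abs_le hsb
    (fun y => FunctionSpaces.Torus.kernel_nonneg hε.le y) (FunctionSpaces.Torus.integral_kernel hε hε')
    (FunctionSpaces.Torus.continuous_kernel hε hε')
  have hBb : ∀ x, |((θ s ⋆ k) ⋆ k) x| ≤ M := abs_convolution_le_of_ae_abs_le (ae_of_all _ hAb)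
    (fun y => FunctionSpaces.Torus.kernel_nonneg hε.le y) (FunctionSpaces.Torus.integral_kernel hε hε')
    (FunctionSpaces.Torus.continuous_kernel hε hε')
  have hw : ∀ᵐ y ∂(volume : Measure (UnitAddTorus d)), |(θ s - (θ s ⋆ k) ⋆ k) y| ≤ 2 * M := by
    filter_upwards [hsb] with y hy
    rw [Pi.sub_apply]
    calc |θ s y - ((θ s ⋆ k) ⋆ k) y| ≤ |θ s y| + |((θ s ⋆ k) ⋆ k) y| := abs_sub _ _
      _ ≤ M + M := add_le_add hy (hBb y)
      _ = 2 * M := by ring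
  have hwm : AEStronglyMeasurable (θ s - (θ s ⋆ k) ⋆ k) volume :=
    hs.1.aestronglyMeasurable.sub hB.continuous.aestronglyMeasurable
  rw [PassiveScalarProofs.eLpNorm_two_pow_two, PassiveScalarProofs.eLpNorm_two_pow_two]
  exact lintegral_enorm_mul_norm_sq_le hw hwm K

/-- **The weighted remainder is square integrable in time**:
`∫₀ᵀ ‖(θ(s) - Bₙ(s))·‖u(s)‖‖²_{L²} ds ≤ (2M)² ‖u‖²_{L²_{t,x}} < ∞`. [cite: MescoliniPitchoSorella2025, Thm. 2.4 proof pp. 1671–1674] -/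
theorem lintegral_remainder_sq_le (h : IsWeakScalarTransportOn T κ u θ₀ θ) {M : ℝ}
    (hθb : ∀ᵐ t ∂(volume.restrict (Ioo 0 T)), ∀ᵐ x ∂(volume : Measure (UnitAddTorus d)), |θ t x| ≤ M)
    {ε : ℝ} (hε : 0 < ε) (hε' : ε ≤ 1 / 4) :
    ∫⁻ s in Ioo 0 T, eLpNorm (fun y => (θ s - (θ s ⋆ FunctionSpaces.Torus.kernel ε) ⋆ FunctionSpaces.Torus.kernel ε) y * ‖u s y‖) 2 volume ^ 2 ≤
      ENNReal.ofReal ((2 * M) ^ 2) * ∫⁻ s in Ioo 0 T, ∫⁻ y, ‖u s y‖ₑ ^ 2 := by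
  rw [← lintegral_const_mul' _ _ ENNReal.ofReal_ne_top]
  refine lintegral_mono_ae ?_
  filter_upwards [h.ae_remainder_sq_le hθb hε hε' 0] with s hs
  refine hs.trans ?_
  rw [sq (0 : ℝ), mul_zero, ENNReal.ofReal_zero, zero_mul, zero_add]
  gcongr with y
  by_cases hy : y ∈ {y | (0 : ℝ) < ‖u s y‖}
  · rw [Set.indicator_of_mem hy]
  · rw [Set.indicator_of_notMem hy]
    exact zero_le

/-- **The weighted remainder of the mollified energy balance vanishes in `L²` in time** (the
replacement, for BOUNDED solutions along `L²` drifts, of the commutator estimate `r^δ → 0` in the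
proof of Mescolini–Pitcho–Sorella 2025, Thm. 2.4 / Bonicatto–Ciampa–Crippa 2024, Lemma 3.1): for a weak
solution `θ` with `|θ| ≤ M` a.e. on `(0,T) × T^d` and a drift `u ∈ L²((0,T) × T^d)`, along
`kₙ = kernel (1/(4(n+1)))`, `Bₙ = (θ ⋆ kₙ) ⋆ kₙ`:
`∫₀ᵀ ‖(θ(s) - Bₙ(s))·‖u(s)‖‖²_{L²} ds → 0` (truncate `u` at height `K`: the bulk is
`≤ 4K² ∫₀ᵀ‖θ ⋆ kₙ - θ‖² → 0`, the tail `≤ 4M² ∫∫_{‖u‖>K} ‖u‖²` is small uniformly in `n`).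
[cite: MescoliniPitchoSorella2025, Thm. 2.4 proof pp. 1671–1674] -/
theorem tendsto_lintegral_remainder_sq (h : IsWeakScalarTransportOn T κ u θ₀ θ) {M : ℝ}
    (hθb : ∀ᵐ t ∂(volume.restrict (Ioo 0 T)), ∀ᵐ x ∂(volume : Measure (UnitAddTorus d)), |θ t x| ≤ M)
    (hu2 : ∫⁻ t in Ioo 0 T, ∫⁻ x, ‖u t x‖ₑ ^ 2 < ⊤) :
    Tendsto (fun n : ℕ => ∫⁻ s in Ioo 0 T, eLpNorm (fun y =>
      (θ s - (θ s ⋆ FunctionSpaces.Torus.kernel (1 / (4 * ((n : ℝ) + 1)))) ⋆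
        FunctionSpaces.Torus.kernel (1 / (4 * ((n : ℝ) + 1)))) y * ‖u s y‖) 2 volume ^ 2) atTop (𝓝 0) := by
  set μT : Measure ℝ := (volume : Measure ℝ).restrict (Ioo 0 T) with hμT
  obtain ⟨hε, hε', -⟩ := molRadius_spec
  set ε : ℕ → ℝ := fun n => 1 / (4 * ((n : ℝ) + 1)) with hε_def
  have hkS : ∀ n, FunctionSpaces.Torus.IsSmooth (FunctionSpaces.Torus.kernel (d := d) (ε n)) :=
    fun n => FunctionSpaces.Torus.isSmooth_kernel (hε n) (hε' n)
  -- notation for the three time integrals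
  set R : ℕ → ℝ≥0∞ := fun n => ∫⁻ s in Ioo 0 T, eLpNorm (fun y =>
      (θ s - (θ s ⋆ FunctionSpaces.Torus.kernel (ε n)) ⋆ FunctionSpaces.Torus.kernel (ε n)) y * ‖u s y‖) 2 volume ^ 2 with hR
  set D : ℕ → ℝ≥0∞ := fun n => ∫⁻ s in Ioo 0 T,
      eLpNorm (θ s - (θ s ⋆ FunctionSpaces.Torus.kernel (ε n)) ⋆ FunctionSpaces.Torus.kernel (ε n)) 2 volume ^ 2 with hD
  set Tl : ℕ → ℝ≥0∞ := fun K => ∫⁻ s in Ioo 0 T, ∫⁻ y,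
      Set.indicator {y | (K : ℝ) < ‖u s y‖} (fun y => ‖u s y‖ₑ ^ 2) y with hTl
  -- `R n ≤ K² D n + 4M² Tl K`
  have hRle : ∀ (n K : ℕ), R n ≤ ENNReal.ofReal ((K : ℝ) ^ 2) * D n + ENNReal.ofReal ((2 * M) ^ 2) * Tl K := by
    intro n K
    simp only [hR, hD, hTl]
    rw [← lintegral_const_mul' _ _ ENNReal.ofReal_ne_top, ← lintegral_const_mul' _ _ ENNReal.ofReal_ne_top,
      ← lintegral_add_left' (((h.aemeasurable_eLpNorm_sub_conv_conv (hkS n).continuous).pow_const 2).const_mul _)]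
    exact lintegral_mono_ae (h.ae_remainder_sq_le hθb (hε n) (hε' n) (K : ℝ))
  -- `D n ≤ 4 ∫ Eₙ² → 0`
  have hD0 : Tendsto D atTop (𝓝 0) := by
    have h4 := ENNReal.Tendsto.const_mul h.tendsto_lintegral_eLpNorm_conv_sub_sq
      (Or.inr (by norm_num) : (0 : ℝ≥0∞) ≠ 0 ∨ (4 : ℝ≥0∞) ≠ ⊤)
    rw [mul_zero] at h4
    refine tendsto_of_tendsto_of_tendsto_of_le_of_le' tendsto_const_nhds h4
      (Eventually.of_forall fun n => zero_le) (Eventually.of_forall fun n => ?_)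
    simp only [hD]
    rw [← lintegral_const_mul' _ _ (by norm_num)]
    refine lintegral_mono_ae ?_
    filter_upwards [h.ae_slice_integrable₁] with s hs
    calc eLpNorm (θ s - (θ s ⋆ FunctionSpaces.Torus.kernel (ε n)) ⋆ FunctionSpaces.Torus.kernel (ε n)) 2 volume ^ 2
        ≤ (2 * eLpNorm (θ s ⋆ FunctionSpaces.Torus.kernel (ε n) - θ s) 2 volume) ^ 2 :=
          pow_le_pow_left' (eLpNorm_sub_conv_conv_le hs.1 (hε n) (hε' n)) 2
      _ = 4 * eLpNorm (θ s ⋆ FunctionSpaces.Torus.kernel (ε n) - θ s) 2 volume ^ 2 := by ring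
  have hTl0 : Tendsto Tl atTop (𝓝 0) := h.tendsto_lintegral_tail_sq hu2
  -- `ε`-argument
  refine ENNReal.tendsto_atTop_zero.2 fun η hη => ?_
  have hη2 : 0 < η / 2 := ENNReal.half_pos hη.ne'
  have hT' : Tendsto (fun K => ENNReal.ofReal ((2 * M) ^ 2) * Tl K) atTop (𝓝 0) := by
    have := ENNReal.Tendsto.const_mul hTl0 (Or.inr ENNReal.ofReal_ne_top :
      (0 : ℝ≥0∞) ≠ 0 ∨ ENNReal.ofReal ((2 * M) ^ 2) ≠ ⊤)
    rwa [mul_zero] at this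
  obtain ⟨K, hK⟩ := ENNReal.tendsto_atTop_zero.1 hT' (η / 2) hη2
  have hD' : Tendsto (fun n => ENNReal.ofReal ((K : ℝ) ^ 2) * D n) atTop (𝓝 0) := by
    have := ENNReal.Tendsto.const_mul hD0 (Or.inr ENNReal.ofReal_ne_top :
      (0 : ℝ≥0∞) ≠ 0 ∨ ENNReal.ofReal ((K : ℝ) ^ 2) ≠ ⊤)
    rwa [mul_zero] at this
  obtain ⟨N, hN⟩ := ENNReal.tendsto_atTop_zero.1 hD' (η / 2) hη2
  refine ⟨N, fun n hn => ?_⟩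
  calc R n ≤ ENNReal.ofReal ((K : ℝ) ^ 2) * D n + ENNReal.ofReal ((2 * M) ^ 2) * Tl K := hRle n K
    _ ≤ η / 2 + η / 2 := add_le_add (hN n hn) (hK K le_rfl)
    _ = η := ENNReal.add_halves η

end IsWeakScalarTransportOn

end Torus

end Literature.Analysis.FluidPDE
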